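import Summits.Langlands.Langlands.Theorems.SqrtFiveQuarticCoversRank0FifteenSqrtFive
import Literature.NumberTheory.EllipticCurves.TwoIsogenyDescentIndex
import HarnessLib

/-!
# Route `Langlands/SqrtFiveQuarticCovers` — FLS's curve `D₁ = 15a8 : Y² = X³ + 5X² + 8X + 16` has
# finitely many points over every quadratic field containing `√5`

Cell lg-quartmod (F-L1), seat eng-6 g4 (lead ruling 2026-08-29T00:12:44Z; helper of stmt-Langlands-23415),
module 3 of the item (after `…Rank0FifteenTwist75`, `…Rank0FifteenSqrtFive`).  MAIN THEOREM

* `finite_point_D1_of_sq_eq_five (K) (hK : finrank ℚ K = 2) (hr : r ^ 2 = 5) :`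
  `Finite (⟨0, 5, 0, 8, 16⟩ : WeierstrassCurve K).toAffine.Point`

(and, along the same chain, `finite_point_15a3_of_sq_eq_five` for Cremona's `15a3 = [1,1,1,-5,2]` — the
curve `E′ ≅ 15a3` of lineage E13 — and `finite_point_twist75_of_sq_eq_five` for the twist
`E₇₅ = 75b3 = [0,25,0,-3800,-78000]`, which over `K ∋ √5` is `K`-isomorphic to `X₀(15)`: so the factors
`15a` AND `75b = 15a ⊗ χ₅` of the row-1 input «rank `0` of `15a`, `75b`, `75c` over `ℚ(√5)`» are
kernel theorems; `75c` — no rational `2`-torsion, `75c ⊗ χ₅ = 75a` — is NOT covered and stays named)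
— the curve `D₁ : Y² = X³ + 5X² + 8X + 16` of Freitas–Le Hung–Siksek (2015), §5.3 p. 26 (the
elliptic quotient `u² = h₁(w)` of `X(s3, b5)`; Cremona `15a8 = [1,1,1,0,0]`, `j = −1/15`), the carrier
`D₁` of the cell's sheet-4.4/4.8 lineages E9′ / E9P3 / ref-1 E9 (row 6 `hE9c` of the NAMED-INPUT
TABLE), has finitely many `K`-points for every quadratic field `K ∋ √5` — the NAMED input «rank
`D₁(ℚ(√5)) = 0` (LV0 RELEASES l.123 + Kolyvagin–Logachev, or `mwrank`)» of those lineages as a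
KERNEL theorem (their torsion datum `D₁(k) ≅ ℤ/8` stays a certnum TORE certificate).

PROOF (plumbing through PROVED tree material): `D₁ = (1, 4, 0, 0) • E` with
`E : y² = x³ − 7x² + 16x` (`x = X + 4`) in two-torsion normal form; the tree's explicit `2`-isogeny
`φ = twoIsogenyHom : E(K) →+ E₂(K)`, `E₂ : y² = x³ + 14x² − 15x`, has kernel `{O, T}`
(`twoIsogenyHom_eq_zero_iff`); `(1, 1, 0, 0) • E₂ = E₃ : y² = x³ + 17x² + 16x`, whose `2`-isogeny
lands in `E₄ : y² = x³ − 34x² + 225x = x(x − 9)(x − 25)`; and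
`E₄ = (1/2, −13/4, −1/2, 9/8) • X₀(15)` (`X₀(15) = [1,1,1,-10,-10]`: `Y² = (X+4)(X+13)(X−12)`,
`X = 4x`, shifted by `13`).  A homomorphism with finite kernel into a finite group has finite source
(`finite_of_finite_ker`), changes of variables are bijections on points (`VariableChange.pointEquiv`),
and `X₀(15)(K)` is finite (`Rank0Fifteen.finite_point_X0_15_of_sq_eq_five`, module 2).  The chain
`D₁ ≅ E → E₂ ≅ E₃ → E₄ ≅ X₀(15)` is the `4`-isogeny `15a8 → 15a1` of Cremona's table.

HONEST STATUS: unconditional kernel theorem about the `K`-points of ONE explicit elliptic curve over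
the quadratic fields `K ∋ √5`; not a BSD or modularity statement; closes no binder of the route's
Record.  Nothing here proves modularity of a new class of elliptic curves.  References:
[FreitasLeHungSiksek2015] §5.3 (p. 26, `D₁`); [SilvermanAEC2009] III.4.5 (the `2`-isogeny), X.4.9;
[CremonaAlgorithms1997] Table 1, `N = 15` (isogeny class `15a`).
-/

noncomputable section

open scoped Classical

set_option linter.dupNamespace false -- project-wide option; `Summit.Langlands.Langlands` is the mandated namespace

namespace Summit.Langlands.Langlands.Theorems.SqrtFiveQuarticCovers

namespace Rank0Fifteen

open _root_.WeierstrassCurve Literature.NumberTheory.EllipticCurves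

/-! ### A homomorphism with finite kernel into a finite group has finite source -/

/-- If `f : A →+ B` has finite kernel and `B` is finite then `A` is finite (the fibres of `f` are
translates of the kernel; `finite_preimage_singleton_of_finite_ker`). [folklore] -/
theorem finite_of_finite_ker {A B : Type*} [AddCommGroup A] [AddCommGroup B] (f : A →+ B)
    (hker : (f.ker : Set A).Finite) (hB : Finite B) : Finite A := by
  have h : (f ⁻¹' Set.univ).Finite :=
    Set.finite_univ.preimage' fun b _ => finite_preimage_singleton_of_finite_ker f hker b
  rw [Set.preimage_univ] at h
  exact Set.finite_univ_iff.mp h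

/-- **Finiteness ascends along the explicit `2`-isogeny**: for `W : y² = x³ + ax² + bx` elliptic in
two-torsion normal form over a field `F`, if `E₂(F)` is finite (`E₂ = W.twoIsogenyCodomain`) then so
is `W(F)` — `φ = twoIsogenyHom` has kernel `{O, T}` (`twoIsogenyHom_eq_zero_iff`, Silverman–Tate
§3.4 Prop. 3.7). [cite: SilvermanAEC2009, III.4 Example 4.5] -/
theorem finite_point_of_finite_twoIsogenyCodomain {F : Type*} [Field F] (W : WeierstrassCurve F)
    [W.IsTwoTorsionNF] [W.IsElliptic] (h : Finite W.twoIsogenyCodomain.toAffine.Point) :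
    Finite W.toAffine.Point := by
  refine finite_of_finite_ker W.twoIsogenyHom ?_ h
  refine (Set.toFinite ({0, W.twoTorsionPoint} : Set W.toAffine.Point)).subset ?_
  intro P hP
  rw [SetLike.mem_coe, AddMonoidHom.mem_ker, twoIsogenyHom_eq_zero_iff] at hP
  rcases hP with hP | hP
  · exact Or.inl hP
  · exact Or.inr hP

/-! ### The four curves of the chain over a field of characteristic `0` -/

section Chain

variable (K : Type) [Field K]

/-- `E : y² = x³ − 7x² + 16x` is in two-torsion normal form. [folklore] -/
theorem isTwoTorsionNF_E : (⟨0, -7, 0, 16, 0⟩ : WeierstrassCurve K).IsTwoTorsionNF := ⟨rfl, rfl, rfl⟩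

/-- `E : y² = x³ − 7x² + 16x` is elliptic: `Δ = 16·16²·(49 − 64) = −61440 ≠ 0`. [folklore] -/
theorem isElliptic_E [CharZero K] : (⟨0, -7, 0, 16, 0⟩ : WeierstrassCurve K).IsElliptic :=
  ⟨by
    rw [show (⟨0, -7, 0, 16, 0⟩ : WeierstrassCurve K).Δ = -61440 by
      norm_num [WeierstrassCurve.Δ, b₂, b₄, b₆, b₈]]
    norm_num⟩

/-- `E₃ : y² = x³ + 17x² + 16x` is in two-torsion normal form. [folklore] -/
theorem isTwoTorsionNF_E₃ : (⟨0, 17, 0, 16, 0⟩ : WeierstrassCurve K).IsTwoTorsionNF := ⟨rfl, rfl, rfl⟩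

/-- `E₃ : y² = x³ + 17x² + 16x` is elliptic: `Δ = 16·16²·(289 − 64) = 921600 ≠ 0`. [folklore] -/
theorem isElliptic_E₃ [CharZero K] : (⟨0, 17, 0, 16, 0⟩ : WeierstrassCurve K).IsElliptic :=
  ⟨by
    rw [show (⟨0, 17, 0, 16, 0⟩ : WeierstrassCurve K).Δ = 921600 by
      norm_num [WeierstrassCurve.Δ, b₂, b₄, b₆, b₈]]
    norm_num⟩

/-- The `2`-isogenous curve of `E` is `E₂ : y² = x³ + 14x² − 15x`. [folklore] -/
theorem twoIsogenyCodomain_E :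
    (⟨0, -7, 0, 16, 0⟩ : WeierstrassCurve K).twoIsogenyCodomain = ⟨0, 14, 0, -15, 0⟩ := by
  ext <;> norm_num [twoIsogenyCodomain]

/-- The `2`-isogenous curve of `E₃` is `E₄ : y² = x³ − 34x² + 225x`. [folklore] -/
theorem twoIsogenyCodomain_E₃ :
    (⟨0, 17, 0, 16, 0⟩ : WeierstrassCurve K).twoIsogenyCodomain = ⟨0, -34, 0, 225, 0⟩ := by
  ext <;> norm_num [twoIsogenyCodomain]

/-- `D₁ : Y² = X³ + 5X² + 8X + 16` is `E` shifted by `x = X + 4`: `(1, 4, 0, 0) • E = D₁`. [folklore] -/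
theorem smul_E_eq_D1 :
    (⟨1, 4, 0, 0⟩ : VariableChange K) • (⟨0, -7, 0, 16, 0⟩ : WeierstrassCurve K) = ⟨0, 5, 0, 8, 16⟩ := by
  ext
  · simp [variableChange_a₁]
  · simp only [variableChange_a₂]; norm_num
  · simp [variableChange_a₃]
  · simp only [variableChange_a₄]; norm_num
  · simp only [variableChange_a₆]; norm_num

/-- `E₃` is `E₂` shifted by `x = x' + 1`: `(1, 1, 0, 0) • E₂ = E₃`. [folklore] -/
theorem smul_E₂_eq_E₃ :
    (⟨1, 1, 0, 0⟩ : VariableChange K) • (⟨0, 14, 0, -15, 0⟩ : WeierstrassCurve K) = ⟨0, 17, 0, 16, 0⟩ := by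
  ext
  · simp [variableChange_a₁]
  · simp only [variableChange_a₂]; norm_num
  · simp [variableChange_a₃]
  · simp only [variableChange_a₄]; norm_num
  · simp only [variableChange_a₆]; norm_num

/-- `E₄ : y² = x³ − 34x² + 225x` is `X₀(15) = [1, 1, 1, -10, -10]` in the coordinates `x = X + 13`,
`X = 4x₁₅`, `y = 4(2y₁₅ + x₁₅ + 1)`: `(1/2, −13/4, −1/2, 9/8) • X₀(15) = E₄`. [folklore] -/
theorem smul_X0_15_eq_E₄ [CharZero K] :
    (⟨⟨(1 / 2 : K), 2, by norm_num, by norm_num⟩, -13 / 4, -1 / 2, 9 / 8⟩ : VariableChange K) •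
        (⟨1, 1, 1, -10, -10⟩ : WeierstrassCurve K) = ⟨0, -34, 0, 225, 0⟩ := by
  ext
  · simp only [variableChange_a₁]; norm_num
  · simp only [variableChange_a₂]; norm_num
  · simp only [variableChange_a₃]; norm_num
  · simp only [variableChange_a₄]; norm_num
  · simp only [variableChange_a₆]; norm_num

/-- Cremona's `15a3 = [1, 1, 1, -5, 2]` is `E₃ : y² = x³ + 17x² + 16x` in the coordinates `x = X − 4`,
`X = 4x₃`, `y = 4(2y₃ + x₃ + 1)` (its `2`-division cubic is `(x₃ − 1)(4x₃ − 3)(x₃ + 3)`):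
`(1/2, 1, −1/2, −1) • 15a3 = E₃`. [cite: CremonaAlgorithms1997, Table 1, N = 15, curve A3] -/
theorem smul_15a3_eq_E₃ [CharZero K] :
    (⟨⟨(1 / 2 : K), 2, by norm_num, by norm_num⟩, 1, -1 / 2, -1⟩ : VariableChange K) •
        (⟨1, 1, 1, -5, 2⟩ : WeierstrassCurve K) = ⟨0, 17, 0, 16, 0⟩ := by
  ext
  · simp only [variableChange_a₁]; norm_num
  · simp only [variableChange_a₂]; norm_num
  · simp only [variableChange_a₃]; norm_num
  · simp only [variableChange_a₄]; norm_num
  · simp only [variableChange_a₆]; norm_num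

end Chain

/-! ### Over `K ∋ √5` the twist `E₇₅ = 75b3` becomes isomorphic to `X₀(15)` -/

/-- Over a field containing `r = √5`, the twist `E₇₅ : y² = (x + 20)(x + 65)(x − 60)` (Cremona `75b3`)
is `X₀(15) = [1, 1, 1, -10, -10]` in the coordinates `x = 20x₁₅`, `y = 20r(2y₁₅ + x₁₅ + 1)`:
`(r/10, 0, −1/2, −1/2) • X₀(15) = E₇₅` (`u = r/10`, `u² = 1/20`). [folklore] -/
theorem smul_X0_15_eq_twist75 (K : Type) [Field K] [CharZero K] {r : K} (hr : r ^ 2 = 5) :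
    (⟨⟨r / 10, 2 * r, by linear_combination hr / 5, by linear_combination hr / 5⟩, 0, -1 / 2, -1 / 2⟩ :
        VariableChange K) • (⟨1, 1, 1, -10, -10⟩ : WeierstrassCurve K) = ⟨0, 25, 0, -3800, -78000⟩ := by
  have hr0 : r ≠ 0 := by rintro rfl; norm_num at hr
  have h4 : (r / 10)⁻¹ = 2 * r := by
    rw [inv_div, div_eq_iff hr0]
    linear_combination -2 * hr
  ext
  · simp only [variableChange_a₁, Units.val_inv_eq_inv_val, h4]; norm_num
  · simp only [variableChange_a₂, Units.val_inv_eq_inv_val, h4]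
    linear_combination (5 : K) * hr
  · simp only [variableChange_a₃, Units.val_inv_eq_inv_val, h4]; norm_num
  · simp only [variableChange_a₄, Units.val_inv_eq_inv_val, h4]
    linear_combination (-152 * r ^ 2 - 760 : K) * hr
  · simp only [variableChange_a₆, Units.val_inv_eq_inv_val, h4]
    linear_combination (-624 * r ^ 4 - 3120 * r ^ 2 - 15600 : K) * hr

/-! ### `D₁(K)` is finite for quadratic `K ∋ √5` -/

/-- **`E₃ ≅ 15a3` has finitely many points over every quadratic field containing `√5`**: along
`E₃ →φ E₄ ≅ X₀(15)` (the tree's explicit `2`-isogeny, kernel `{O, T}`, and the change of variables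
`smul_X0_15_eq_E₄`) finiteness ascends from `X₀(15)(K)` (`finite_point_X0_15_of_sq_eq_five`).
[cite: SilvermanAEC2009, III.4 Example 4.5] -/
theorem finite_point_E₃_of_sq_eq_five (K : Type) [Field K] [CharZero K]
    (hK : Module.finrank ℚ K = 2) {r : K} (hr : r ^ 2 = 5) :
    Finite (⟨0, 17, 0, 16, 0⟩ : WeierstrassCurve K).toAffine.Point := by
  -- `X₀(15)(K)` is finite, hence `E₄(K)`
  have h15 := finite_point_X0_15_of_sq_eq_five K hK hr
  have h₄ : Finite (⟨0, -34, 0, 225, 0⟩ : WeierstrassCurve K).toAffine.Point := by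
    have e := (VariableChange.pointEquiv (⟨1, 1, 1, -10, -10⟩ : WeierstrassCurve K)
      (⟨⟨(1 / 2 : K), 2, by norm_num, by norm_num⟩, -13 / 4, -1 / 2, 9 / 8⟩ : VariableChange K)).trans
      (Affine.Point.congrEquiv (smul_X0_15_eq_E₄ K))
    exact Finite.of_equiv _ e.toEquiv
  -- hence `E₃(K)` along `φ`
  haveI := isTwoTorsionNF_E₃ K
  haveI := isElliptic_E₃ K
  refine finite_point_of_finite_twoIsogenyCodomain _ ?_
  rw [twoIsogenyCodomain_E₃]
  exact h₄

/-- **Cremona's `15a3 = [1, 1, 1, -5, 2]` (the curve `E′ ≅ 15a3` of the sheet-4.2/4.6 lineage E13)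
has finitely many points over every quadratic field containing `√5`** (transport of
`finite_point_E₃_of_sq_eq_five` along `smul_15a3_eq_E₃`). [cite: CremonaAlgorithms1997, Table 1, N = 15, curve A3] -/
theorem finite_point_15a3_of_sq_eq_five (K : Type) [Field K] [CharZero K]
    (hK : Module.finrank ℚ K = 2) {r : K} (hr : r ^ 2 = 5) :
    Finite (⟨1, 1, 1, -5, 2⟩ : WeierstrassCurve K).toAffine.Point := by
  have h₃ := finite_point_E₃_of_sq_eq_five K hK hr
  have e := (VariableChange.pointEquiv (⟨1, 1, 1, -5, 2⟩ : WeierstrassCurve K)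
    (⟨⟨(1 / 2 : K), 2, by norm_num, by norm_num⟩, 1, -1 / 2, -1⟩ : VariableChange K)).trans
    (Affine.Point.congrEquiv (smul_15a3_eq_E₃ K))
  exact Finite.of_equiv _ e.toEquiv.symm

/-- **FLS's `D₁ = 15a8` has finitely many points over every quadratic field containing `√5`.**  For a
field `K` with `[K:ℚ] = 2` and `r ∈ K`, `r² = 5`, the curve `Y² = X³ + 5X² + 8X + 16`
(Freitas–Le Hung–Siksek 2015, §5.3; Cremona `15a8`) has finitely many `K`-rational points: along the
chain `D₁ ≅ E →φ E₂ ≅ E₃ →φ E₄ ≅ X₀(15)` (two explicit `2`-isogenies with kernels `{O, T}` and three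
changes of variables; the `4`-isogeny `15a8 → 15a3 → 15a1`) finiteness ascends from `X₀(15)(K)`, which
is finite by `finite_point_X0_15_of_sq_eq_five` (rank `0` of `15a` and of its twist `75b` over `ℚ` by
complete `2`-descents in the kernel, and Silverman's quadratic finiteness transfer).  This is the
rank-`0` half of the NAMED input of the row-6 lineages (E9′, E9P3) as a kernel theorem; not a BSD or
modularity statement. [cite: FreitasLeHungSiksek2015, §5.3 (p. 26, the curve D₁); SilvermanAEC2009, III.4 Example 4.5 and Exercise 10.16] -/
theorem finite_point_D1_of_sq_eq_five (K : Type) [Field K] [CharZero K]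
    (hK : Module.finrank ℚ K = 2) {r : K} (hr : r ^ 2 = 5) :
    Finite (⟨0, 5, 0, 8, 16⟩ : WeierstrassCurve K).toAffine.Point := by
  have h₃ := finite_point_E₃_of_sq_eq_five K hK hr
  -- `E₂(K)` by the shift `x = x' + 1`
  have h₂ : Finite (⟨0, 14, 0, -15, 0⟩ : WeierstrassCurve K).toAffine.Point := by
    have e := (VariableChange.pointEquiv (⟨0, 14, 0, -15, 0⟩ : WeierstrassCurve K)
      (⟨1, 1, 0, 0⟩ : VariableChange K)).trans (Affine.Point.congrEquiv (smul_E₂_eq_E₃ K))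
    exact Finite.of_equiv _ e.toEquiv.symm
  -- hence `E(K)` along `φ`
  have h₁ : Finite (⟨0, -7, 0, 16, 0⟩ : WeierstrassCurve K).toAffine.Point := by
    haveI := isTwoTorsionNF_E K
    haveI := isElliptic_E K
    refine finite_point_of_finite_twoIsogenyCodomain _ ?_
    rw [twoIsogenyCodomain_E]
    exact h₂
  -- hence `D₁(K)` by the shift `x = X + 4`
  have e := (VariableChange.pointEquiv (⟨0, -7, 0, 16, 0⟩ : WeierstrassCurve K)
    (⟨1, 4, 0, 0⟩ : VariableChange K)).trans (Affine.Point.congrEquiv (smul_E_eq_D1 K))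
  haveI := h₁
  exact Finite.of_equiv _ e.toEquiv

/-- **Cremona's class `75b` has rank `0` over `ℚ(√5)`**: over a quadratic field `K ∋ √5` the twist
`E₇₅ = 75b3 : y² = (x + 20)(x + 65)(x − 60)` is `K`-isomorphic to `X₀(15)` (`smul_X0_15_eq_twist75`),
so `E₇₅(K)` is finite.  With `finite_point_X0_15_of_sq_eq_five` this covers the factors `15a` and
`75b = 15a ⊗ χ₅` of the row-1 lineages' input «rank `0` of `15a`, `75b`, `75c` over `ℚ(√5)`»; the
factor `75c` (no rational `2`-torsion; `75c ⊗ χ₅ = 75a`) is NOT covered and stays named.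
[cite: CremonaAlgorithms1997, Table 1, N = 75 (class B)] -/
theorem finite_point_twist75_of_sq_eq_five (K : Type) [Field K] [CharZero K]
    (hK : Module.finrank ℚ K = 2) {r : K} (hr : r ^ 2 = 5) :
    Finite (⟨0, 25, 0, -3800, -78000⟩ : WeierstrassCurve K).toAffine.Point := by
  have h15 := finite_point_X0_15_of_sq_eq_five K hK hr
  have e := (VariableChange.pointEquiv (⟨1, 1, 1, -10, -10⟩ : WeierstrassCurve K)
    (⟨⟨r / 10, 2 * r, by linear_combination hr / 5, by linear_combination hr / 5⟩, 0, -1 / 2, -1 / 2⟩ :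
      VariableChange K)).trans (Affine.Point.congrEquiv (smul_X0_15_eq_twist75 K hr))
  exact Finite.of_equiv _ e.toEquiv

end Rank0Fifteen

end Summit.Langlands.Langlands.Theorems.SqrtFiveQuarticCovers

end
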